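import Summits.Ventures.Crystal3D.Theorems.StickyWulffConstantNoReconstructionGainCoplanarFilm
import HarnessLib

/-!
# Placement-free rungs of the atom: any plug cut from `Λ₀` by a midpoint-convex gauge

HONEST FRAMING. Part of the venture `Summits/Ventures/Crystal3D` (cell `crystal3d-full`), helper
`--supports` the crux `NoReconstructionGain` (stmt-Ventures-19144, route
`route-Ventures-StickyWulffConstant`), line `adhesion`.  Planner cf-p1 g16 (INBOX 11:51:55Z) asked for
the atom's rungs in UNIFORM form — constants and arguments that do not depend on where the clamped plate
sits, so that they lift verbatim to the T line's `stub_barlowAdhesion` (every placement `L·Λ + s` of the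
substrate against the origin-anchored window) and to the wall cells.  The R26 chain of this lineage
(`…Registry`, `…OffRegistry`, `…Peeling`, `…OffRegistryDegenerate`, `…CoplanarFilm`) uses the slab
window only through TWO facts: the plug consists of lattice sites, and a MIDPOINT-CONVEX gauge puts every
plug site strictly below every lattice-site film ball (`slabGauge`).  This file re-runs the chain with
exactly these two facts as hypotheses, so the window disappears from the statements:

* `exists_potential_of_offRegistry_gauge` — g5's reduction L5 (`exists_potential_of_offRegistry`,
  p522036) for an ARBITRARY plug `P ⊆ Λ₀` separated from the registry film balls by a midpoint-convex
  gauge `f` (`f p < f q` for `p ∈ P`, `q ∈ (X \ P) ∩ Λ₀`; `2 f q ≤ f (q + w) + f (q − w)`);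
* `gaugePlug_threeDegenerate_adhesion` — the contact-3-degenerate rung (g5 p523683) in that form:
  NO normal, NO radius, NO thickness, `C = 0`: `#cross(P, X \ P) ≤ contactDeficiency (X \ P)`;
* `gaugePlug_coplanarOffLattice_adhesion` — the coplanar rung (g6 p534880) in that form.

Every convex window in any position qualifies (take for `f` any midpoint-convex function whose sublevel
set `{f ≤ c}` cuts exactly the plug out of `Λ₀`; for the registered `ν`-slab window this is the landed
`slabGauge`, so the registered-window rungs are instances).  The moved-lattice form (`A·Λ₀ + t`) follows by
pulling back through the rigid motion (next file).

WHAT THIS IS NOT: any new class of films (the off-lattice part must still be contact-3-degenerate /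
coplanar); the atom; rung F-C1 not moved.
-/

noncomputable section

namespace Summit.Ventures.Crystal3D.Theorems

open Summit.Ventures.Crystal3D Finset
open Literature.MathematicalPhysics.StatisticalMechanics (fccStacking orderedContacts contactDeficiency)
open scoped InnerProductSpace

/-! ### L5 with a general gauge -/

/-- **Only the off-registry balls need a certificate — gauge form.**  `X ⊇ P` finite, `P ⊆ Λ₀`, `O ⊆ X \ P`
with `(X \ P) \ O ⊆ Λ₀`; `f` a midpoint-convex gauge with `f p < f q` whenever `p ∈ P` and `q` is a
registry film ball; `Ψ` an integer potential satisfying (T2) at every `q ∈ O \ E` for the ENLARGED plug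
`X \ O`.  Then some integer potential satisfies (T2) relative to `P` at every film ball off `E`. -/
theorem exists_potential_of_offRegistry_gauge (X P O E : Finset (EuclideanSpace ℝ (Fin 3))) (hPX : P ⊆ X)
    (hPΛ : ∀ p ∈ P, p ∈ fccStacking 1 (Real.sqrt (2 / 3)))
    (hO : O ⊆ X \ P) (hreg : ∀ x ∈ (X \ P) \ O, x ∈ fccStacking 1 (Real.sqrt (2 / 3)))
    (f : EuclideanSpace ℝ (Fin 3) → ℝ)
    (hsep : ∀ p ∈ P, ∀ q ∈ (X \ P) \ O, f p < f q)
    (hconv : ∀ q w : EuclideanSpace ℝ (Fin 3), 2 * f q ≤ f (q + w) + f (q - w))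
    (Ψ : EuclideanSpace ℝ (Fin 3) → ℤ)
    (hΨ : ∀ q ∈ O \ E,
      (((X \ (X \ O)).filter fun x => dist q x = 1 ∧ Ψ x < Ψ q).card : ℤ)
          + (((X \ O).filter fun p => dist q p = 1).card : ℤ)
        ≤ (12 - ((X.filter fun x => dist q x = 1).card : ℤ))
          + (((X \ (X \ O)).filter fun x => dist q x = 1 ∧ Ψ q < Ψ x).card : ℤ)) :
    ∃ Φ : EuclideanSpace ℝ (Fin 3) → ℤ, ∀ q ∈ (X \ P) \ E,
      (((X \ P).filter fun x => dist q x = 1 ∧ Φ x < Φ q).card : ℤ)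
          + ((P.filter fun p => dist q p = 1).card : ℤ)
        ≤ (12 - ((X.filter fun x => dist q x = 1).card : ℤ))
          + (((X \ P).filter fun x => dist q x = 1 ∧ Φ q < Φ x).card : ℤ) := by
  classical
  set Rg := (X \ P) \ O with hRg
  have hOX : O ⊆ X := hO.trans sdiff_subset
  have hXO : X \ (X \ O) = O := Finset.sdiff_sdiff_eq_self hOX
  -- the rank of the gauge on the registry film
  set rk : EuclideanSpace ℝ (Fin 3) → ℤ := fun x => ((Rg.filter fun y => f y < f x).card : ℤ) with hrk
  have hrk_le : ∀ x, rk x ≤ Rg.card := fun x => by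
    simp only [hrk]; exact_mod_cast card_le_card (filter_subset _ _)
  have hrk_nn : ∀ x, 0 ≤ rk x := fun x => by simp only [hrk]; positivity
  -- lift `Ψ` above every rank
  set M : ℤ := (Rg.card : ℤ) + 1 + ∑ y ∈ O, |Ψ y| with hM
  have hMbig : ∀ x, ∀ y ∈ O, rk x < Ψ y + M := by
    intro x y hy
    have h1 : -|Ψ y| ≤ Ψ y := neg_abs_le _
    have h2 : |Ψ y| ≤ ∑ y ∈ O, |Ψ y| := single_le_sum (fun z _ => abs_nonneg (Ψ z)) hy
    have := hrk_le x
    linarith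
  let Φ : EuclideanSpace ℝ (Fin 3) → ℤ := fun y => if y ∈ O then Ψ y + M else rk y
  have hΦO : ∀ y ∈ O, Φ y = Ψ y + M := fun y hy => by simp [Φ, hy]
  have hΦR : ∀ y, y ∉ O → Φ y = rk y := fun y hy => by simp [Φ, hy]
  refine ⟨Φ, fun q hq => ?_⟩
  rw [mem_sdiff] at hq
  obtain ⟨hqXP, hqE⟩ := hq
  by_cases hqO : q ∈ O
  · -- an off-registry ball: the hypothesis, re-counted
    have h := hΨ q (mem_sdiff.2 ⟨hqO, hqE⟩)
    rw [noGainPotential_iff X (X \ O) sdiff_subset Ψ q, hXO] at h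
    rw [noGainPotential_iff X P hPX Φ q]
    have hq' : Φ q = Ψ q + M := hΦO q hqO
    have hb : ((X \ P).filter fun x => dist q x = 1 ∧ Φ x < Φ q).card =
        (O.filter fun x => dist q x = 1 ∧ Ψ x < Ψ q).card + (Rg.filter fun x => dist q x = 1).card := by
      rw [← card_union_of_disjoint]
      · congr 1
        ext x
        simp only [mem_union, mem_filter, hRg, mem_sdiff]
        constructor
        · rintro ⟨hx, hd, hlt⟩
          by_cases hxO : x ∈ O
          · left; refine ⟨hxO, hd, ?_⟩; rw [hΦO x hxO, hq'] at hlt; linarith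
          · right; exact ⟨⟨hx, hxO⟩, hd⟩
        · rintro (⟨hxO, hd, hlt⟩ | ⟨⟨hx, hxO⟩, hd⟩)
          · refine ⟨mem_sdiff.1 (hO hxO), hd, ?_⟩; rw [hΦO x hxO, hq']; linarith
          · refine ⟨hx, hd, ?_⟩; rw [hΦR x hxO, hq']; exact hMbig x q hqO
      · exact disjoint_left.2 fun x h1 h2 => by
          rw [mem_filter] at h1 h2; exact (mem_sdiff.1 h2.1).2 h1.1
    have hl : ((X \ P).filter fun x => dist q x = 1 ∧ Φ x = Φ q) =
        (O.filter fun x => dist q x = 1 ∧ Ψ x = Ψ q) := by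
      ext x
      simp only [mem_filter]
      constructor
      · rintro ⟨hx, hd, he⟩
        by_cases hxO : x ∈ O
        · refine ⟨hxO, hd, ?_⟩; rw [hΦO x hxO, hq'] at he; linarith
        · exfalso; rw [hΦR x hxO, hq'] at he; exact absurd he (hMbig x q hqO).ne
      · rintro ⟨hxO, hd, he⟩
        refine ⟨hO hxO, hd, ?_⟩; rw [hΦO x hxO, hq', he]
    have hc : ((X \ O).filter fun p => dist q p = 1).card =
        (P.filter fun p => dist q p = 1).card + (Rg.filter fun x => dist q x = 1).card := by
      rw [← card_union_of_disjoint]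
      · congr 1
        ext x
        simp only [mem_union, mem_filter, hRg, mem_sdiff]
        constructor
        · rintro ⟨⟨hx, hxO⟩, hd⟩
          by_cases hxP : x ∈ P
          · exact Or.inl ⟨hxP, hd⟩
          · exact Or.inr ⟨⟨⟨hx, hxP⟩, hxO⟩, hd⟩
        · rintro (⟨hxP, hd⟩ | ⟨⟨⟨hx, hxP⟩, hxO⟩, hd⟩)
          · exact ⟨⟨hPX hxP, fun hxO => (mem_sdiff.1 (hO hxO)).2 hxP⟩, hd⟩
          · exact ⟨⟨hx, hxO⟩, hd⟩
      · exact disjoint_left.2 fun x h1 h2 => by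
          rw [mem_filter] at h1 h2; exact (mem_sdiff.1 (mem_sdiff.1 h2.1).1).2 h1.1
    rw [hb, hl]; rw [hc] at h
    push_cast at h ⊢
    linarith
  · -- a registry ball: the antipodal-pair argument with the gauge order
    have hqR : q ∈ Rg := by rw [hRg]; exact mem_sdiff.2 ⟨hqXP, hqO⟩
    have hq' : Φ q = rk q := hΦR q hqO
    refine registry_noGainPotential X P Rg hPX sdiff_subset hPΛ hreg q hqR Φ f ?_ ?_ ?_ ?_ ?_
    · intro x hx _
      have hxO : x ∈ O := by
        rw [hRg, Finset.sdiff_sdiff_eq_self hO] at hx; exact hx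
      rw [hq', hΦO x hxO]; exact hMbig q x hxO
    · intro x hx _
      have hxO : x ∉ O := (mem_sdiff.1 hx).2
      rw [hq', hΦR x hxO]; exact rank_lt_iff Rg f x q hx
    · intro x hx _
      have hxO : x ∉ O := (mem_sdiff.1 hx).2
      rw [hq', hΦR x hxO]; exact rank_eq_iff Rg f x q hx hqR
    · intro p hp _
      exact hsep p hp q hqR
    · intro w
      exact hconv q w

/-! ### The placement-free contact-3-degenerate rung -/

/-- **The atom for films with contact-3-degenerate off-lattice part, for ANY plug cut from `Λ₀` by a
midpoint-convex gauge** (no normal, no radius, `C = 0`).  `X ⊇ P` a finite unit packing, `P ⊆ Λ₀`,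
`f` midpoint-convex with `f p < f q` for every `p ∈ P` and every lattice-site film ball `q`; if every
nonempty set of off-lattice film balls has a ball with `≤ 3` partners in it, then
`#cross(P, X \ P) ≤ contactDeficiency (X \ P)`. -/
theorem gaugePlug_threeDegenerate_adhesion (X P : Finset (EuclideanSpace ℝ (Fin 3)))
    (hX : ∀ p ∈ X, ∀ q ∈ X, p ≠ q → 1 ≤ dist p q) (hPX : P ⊆ X)
    (hPΛ : ∀ p ∈ P, p ∈ fccStacking 1 (Real.sqrt (2 / 3)))
    (f : EuclideanSpace ℝ (Fin 3) → ℝ)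
    (hsep : ∀ p ∈ P, ∀ q ∈ X \ P, q ∈ fccStacking 1 (Real.sqrt (2 / 3)) → f p < f q)
    (hconv : ∀ q w : EuclideanSpace ℝ (Fin 3), 2 * f q ≤ f (q + w) + f (q - w))
    (hdeg : ∀ S ⊆ X \ P, (∀ x ∈ S, x ∉ fccStacking 1 (Real.sqrt (2 / 3))) → S.Nonempty →
      ∃ q ∈ S, (S.filter fun x => dist q x = 1).card ≤ 3) :
    ((((P ×ˢ (X \ P)).filter fun pq => dist pq.1 pq.2 = 1).card : ℕ) : ℝ) ≤
      contactDeficiency (X \ P) := by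
  classical
  set O := (X \ P).filter fun x => x ∉ fccStacking 1 (Real.sqrt (2 / 3)) with hOdef
  have hO : O ⊆ X \ P := filter_subset _ _
  have hOX : O ⊆ X := hO.trans sdiff_subset
  have hXO : X \ (X \ O) = O := Finset.sdiff_sdiff_eq_self hOX
  have hreg : ∀ x ∈ (X \ P) \ O, x ∈ fccStacking 1 (Real.sqrt (2 / 3)) := by
    intro x hx
    rw [mem_sdiff, hOdef, mem_filter] at hx
    by_contra hxΛ
    exact hx.2 ⟨hx.1, hxΛ⟩
  have hoff : ∀ x ∈ O, x ∉ fccStacking 1 (Real.sqrt (2 / 3)) := fun x hx => (mem_filter.1 hx).2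
  have hplugΛ : ∀ y ∈ X \ O, y ∈ fccStacking 1 (Real.sqrt (2 / 3)) := by
    intro y hy
    by_cases hyP : y ∈ P
    · exact hPΛ y hyP
    · exact hreg y (mem_sdiff.2 ⟨mem_sdiff.2 ⟨(mem_sdiff.1 hy).1, hyP⟩, (mem_sdiff.1 hy).2⟩)
  -- `O` is 6-degenerate relative to the enlarged plug `X \ O`
  have hsix : ∀ S ⊆ X \ (X \ O), S.Nonempty →
      ∃ q ∈ S, (((X \ O) ∪ S).filter fun x => dist q x = 1).card ≤ 6 := by
    intro S hS hSne
    rw [hXO] at hS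
    obtain ⟨q, hqS, hq3⟩ := hdeg S (hS.trans hO) (fun x hx => hoff x (hS hx)) hSne
    refine ⟨q, hqS, ?_⟩
    have hplug3 : ((X \ O).filter fun x => dist q x = 1).card ≤ 3 :=
      fcc_offLattice_unitContacts_le_three q (hoff q (hS hqS)) _
        (fun y hy => ⟨hplugΛ y (mem_filter.1 hy).1, (mem_filter.1 hy).2⟩)
    calc (((X \ O) ∪ S).filter fun x => dist q x = 1).card
        ≤ ((X \ O).filter fun x => dist q x = 1).card + (S.filter fun x => dist q x = 1).card := by
          rw [filter_union]; exact card_union_le _ _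
      _ ≤ 6 := by omega
  obtain ⟨Ψ, hΨ⟩ := exists_potential_of_sixDegenerate X (X \ O) (X \ (X \ O)) sdiff_subset
    subset_rfl hsix
  have hΨ' : ∀ q ∈ O \ (∅ : Finset (EuclideanSpace ℝ (Fin 3))),
      (((X \ (X \ O)).filter fun x => dist q x = 1 ∧ Ψ x < Ψ q).card : ℤ)
          + (((X \ O).filter fun p => dist q p = 1).card : ℤ)
        ≤ (12 - ((X.filter fun x => dist q x = 1).card : ℤ))
          + (((X \ (X \ O)).filter fun x => dist q x = 1 ∧ Ψ q < Ψ x).card : ℤ) := by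
    intro q hq
    rw [sdiff_empty] at hq
    exact hΨ q (by rw [hXO]; exact hq)
  obtain ⟨Φ, hΦ⟩ := exists_potential_of_offRegistry_gauge X P O ∅ hPX hPΛ hO hreg f
    (fun p hp q hq => hsep p hp q (mem_sdiff.1 hq).1 (hreg q hq)) hconv Ψ hΨ'
  have h := cross_le_of_potential X P ∅ hX hPX (empty_subset _) Φ hΦ
  simpa using h

/-- **The atom for films with COPLANAR off-lattice part, for any gauge-cut plug** (`C = 0`). -/
theorem gaugePlug_coplanarOffLattice_adhesion (X P : Finset (EuclideanSpace ℝ (Fin 3)))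
    (hX : ∀ p ∈ X, ∀ q ∈ X, p ≠ q → 1 ≤ dist p q) (hPX : P ⊆ X)
    (hPΛ : ∀ p ∈ P, p ∈ fccStacking 1 (Real.sqrt (2 / 3)))
    (f : EuclideanSpace ℝ (Fin 3) → ℝ)
    (hsep : ∀ p ∈ P, ∀ q ∈ X \ P, q ∈ fccStacking 1 (Real.sqrt (2 / 3)) → f p < f q)
    (hconv : ∀ q w : EuclideanSpace ℝ (Fin 3), 2 * f q ≤ f (q + w) + f (q - w))
    (c n : EuclideanSpace ℝ (Fin 3)) (hn : n ≠ 0)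
    (hplane : ∀ x ∈ X \ P, x ∉ fccStacking 1 (Real.sqrt (2 / 3)) → ⟪x - c, n⟫_ℝ = 0) :
    ((((P ×ˢ (X \ P)).filter fun pq => dist pq.1 pq.2 = 1).card : ℕ) : ℝ) ≤
      contactDeficiency (X \ P) := by
  refine gaugePlug_threeDegenerate_adhesion X P hX hPX hPΛ f hsep hconv ?_
  intro S hS hoff hne
  refine exists_card_partners_le_three_of_coplanar S ?_ hne c n hn ?_
  · intro p hp q hq hpq
    exact hX p (sdiff_subset (hS hp)) q (sdiff_subset (hS hq)) hpq
  · intro p hp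
    exact hplane p (hS hp) (hoff p hp)

/-! ### The registered window is a gauge-cut plug -/

/-- The `ν`-slab sample of the registered atom is cut from `Λ₀` by the midpoint-convex `slabGauge`, so the
gauge-form rungs contain the registered-window rungs (sanity link; `R, ρ > 0`). -/
theorem slabSample_gauge (ν : EuclideanSpace ℝ (Fin 3)) (hν : ‖ν‖ = 1) (R ρ : ℝ) (hR : 0 < R)
    (hρ : 0 < ρ) (X P : Finset (EuclideanSpace ℝ (Fin 3)))
    (hP : ∀ p, p ∈ P ↔ (p ∈ fccStacking 1 (Real.sqrt (2 / 3)) ∧ -(2 * R) ≤ ⟪p, ν⟫_ℝ ∧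
      ⟪p, ν⟫_ℝ ≤ -R ∧ ‖p‖ ^ 2 - ⟪p, ν⟫_ℝ ^ 2 ≤ ρ ^ 2)) :
    (∀ p ∈ P, p ∈ fccStacking 1 (Real.sqrt (2 / 3))) ∧
    (∀ p ∈ P, ∀ q ∈ X \ P, q ∈ fccStacking 1 (Real.sqrt (2 / 3)) →
      max (ρ ^ 2 * (2 * ⟪p, ν⟫_ℝ + 3 * R) ^ 2) (R ^ 2 * (‖p‖ ^ 2 - ⟪p, ν⟫_ℝ ^ 2)) <
      max (ρ ^ 2 * (2 * ⟪q, ν⟫_ℝ + 3 * R) ^ 2) (R ^ 2 * (‖q‖ ^ 2 - ⟪q, ν⟫_ℝ ^ 2))) ∧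
    (∀ q w : EuclideanSpace ℝ (Fin 3),
      2 * max (ρ ^ 2 * (2 * ⟪q, ν⟫_ℝ + 3 * R) ^ 2) (R ^ 2 * (‖q‖ ^ 2 - ⟪q, ν⟫_ℝ ^ 2)) ≤
      max (ρ ^ 2 * (2 * ⟪q + w, ν⟫_ℝ + 3 * R) ^ 2) (R ^ 2 * (‖q + w‖ ^ 2 - ⟪q + w, ν⟫_ℝ ^ 2)) +
      max (ρ ^ 2 * (2 * ⟪q - w, ν⟫_ℝ + 3 * R) ^ 2) (R ^ 2 * (‖q - w‖ ^ 2 - ⟪q - w, ν⟫_ℝ ^ 2))) := by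
  refine ⟨fun p hp => ((hP p).1 hp).1, fun p hp q hq hqΛ => ?_, fun q w => slabGauge_midpoint ν hν R ρ q w⟩
  obtain ⟨-, h1, h2, h3⟩ := (hP p).1 hp
  have hqP : q ∉ P := (mem_sdiff.1 hq).2
  have hnot : ¬(-(2 * R) ≤ ⟪q, ν⟫_ℝ ∧ ⟪q, ν⟫_ℝ ≤ -R ∧ ‖q‖ ^ 2 - ⟪q, ν⟫_ℝ ^ 2 ≤ ρ ^ 2) :=
    fun h => hqP ((hP q).2 ⟨hqΛ, h⟩)
  exact lt_of_le_of_lt (slabGauge_le ν R ρ p h1 h2 h3) (lt_slabGauge ν R ρ hR hρ q hnot)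

end Summit.Ventures.Crystal3D.Theorems

end
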